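import Literature.MathematicalPhysics.QuantumLattice.TorusLiebRobinsonProofs
import Literature.MathematicalPhysics.QuantumLattice.QuasiLocalPiecesProofs
import Literature.MathematicalPhysics.QuantumLattice.LiebRobinsonProofs
import Literature.MathematicalPhysics.QuantumLattice.QuasiAdiabaticGenerator
import Literature.MathematicalPhysics.QuantumLattice.SmoothingLocalityProofs
import Literature.MathematicalPhysics.QuantumLattice.SpectralSmoothingProofs
import Literature.MathematicalPhysics.QuantumLattice.CentredLTQOProofs
import HarnessLib

/-!
# Two finite-range dynamics compared, polynomially in time and uniformly in the volume

Twenty-fifth file of the formalisation of the Michalakis–Zwolak stability theorem (hubbard.S19):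
the dynamics part of MZ13 Lemma 1 (v) (Michalakis–Zwolak, arXiv:1109.1588 §5.1, p. 11:
"Duhamel's differentiation formula implies `𝓕_s(Q_u) − 𝓕₀(Q_u) = ∫ dt w_γ(t) ∫₀ˢ ∂_{s'}
τ_t^{H_{s'}}(Q_u) ds'` … a careful application of Lieb–Robinson bounds"). On the decorated torus
`(ℤ/L)^d × κ`, for the dynamics of a local interaction `Φ` of range `r₀` (Lieb–Robinson data
`(J, V)` as in `norm_comm_heisenbergEvolution_ball_le`) and of `H' = H_Φ − c H_W` with `W` a
local interaction of range `r`, `‖W Z‖ ≤ 1`, and a strictly local observable `O ∈ 𝔄_{b_x(R)}`: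

* `card_filter_not_disjoint_cellBall_le` — at most `|b_x(R')| 2^{(2r+1)^d|κ|}` terms of `W`
  meet a ball `b_x(R')`;
* `sum_norm_comm_heisenbergEvolution_le` — the light-cone sum `Σ_Z ‖[W Z, τ_t(O)]‖`, grouping
  the terms by the first ball `b_x(R+n)` they meet and using the torus Lieb–Robinson bound per
  class (`TorusLiebRobinsonProofs`);
* `sum_pow_mul_min_exp_le` — its evaluation `Σ_n (2(R+n)+1)^d min(1, C₁e^{−an+τ}) ≤
  (2(R+n⋆)+1)^d (n⋆ + 1 + d!(6/a)^d (2/a))`, `n⋆ = ⌈(τ + max 0 (log C₁))/a⌉₊`, i.e. polynomial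
  growth in the time (`sum_exp_neg_mul_le`, `pow_mul_exp_neg_le`);
* `norm_heisenbergEvolution_sub_perturbed_le` — with Duhamel's formula in the Hamiltonian
  (`norm_heisenbergEvolution_sub_heisenbergEvolution_le_of_le`, `QuasiAdiabaticGenerator`):
  `‖τ_t^{Φ}(O) − τ_t^{H'}(O)‖ ≤ |c| |t| 2‖O‖ (1 + 2^{(2r+1)^d|κ|} |κ| P(|t|))` with `P` of degree
  `d + 1` in `|t|`, all constants independent of `L`;
* `norm_smoothing_sub_perturbed_le` — integrating against a weight `w` with finite first and
  `(d+2)`-nd absolute moments (MZ13 Lemma 1 (v), norm part):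
  `‖∫ w(t) τ_t^{Φ}(O) dt − ∫ w(t) τ_t^{H'}(O) dt‖ ≤ |c| ‖O‖ C` with `C` explicit in the moments of
  `w` and the data (`lightConePoly_le`, `add_pow_le_two_pow_mul_add_pow`).

No definitions, no named facts (theorems only).
-/

noncomputable section

open Matrix Complex Finset
open scoped Matrix.Norms.L2Operator

namespace Literature.MathematicalPhysics.QuantumLattice

open Literature.Probability.LatticeModels

section LightCone

variable {d L : ℕ} [NeZero L] {κ : Type*} [Fintype κ] [DecidableEq κ] {q : ℕ}

/-- **Counting the perturbation terms meeting a ball**: the number of regions `Z` of diameter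
`≤ r` with `V Z ≠ 0` meeting `b_x(R')` is at most `|b_x(R')| · 2^{(2r+1)^d |κ|}`. [folklore] -/
theorem card_filter_not_disjoint_cellBall_le {V : Interaction (TorusSite d L × κ) q} {r : ℕ}
    (hVr : ∀ Z, r < torusDiam Z → V Z = 0) (x : TorusSite d L) (R' : ℕ) :
    #(univ.filter fun Z : Finset (TorusSite d L × κ) =>
        V Z ≠ 0 ∧ ¬ Disjoint Z (cellBall x R')) ≤
      #(cellBall x R' : Finset (TorusSite d L × κ)) * 2 ^ ((2 * r + 1) ^ d * Fintype.card κ) := by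
  -- each such `Z` contains a point `y` of the ball and then lies in `b_y(r)`
  have hcover : (univ.filter fun Z : Finset (TorusSite d L × κ) =>
      V Z ≠ 0 ∧ ¬ Disjoint Z (cellBall x R')) ⊆
      (cellBall x R' : Finset (TorusSite d L × κ)).biUnion fun y =>
        univ.filter fun Z : Finset (TorusSite d L × κ) => V Z ≠ 0 ∧ y ∈ Z := by
    intro Z hZ
    simp only [mem_filter, mem_univ, true_and] at hZ
    obtain ⟨y, hyZ, hyB⟩ := not_disjoint_iff.mp hZ.2
    exact mem_biUnion.mpr ⟨y, hyB, by simp [hZ.1, hyZ]⟩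
  refine (card_le_card hcover).trans ((card_biUnion_le).trans ?_)
  have hy : ∀ y ∈ (cellBall x R' : Finset (TorusSite d L × κ)),
      #(univ.filter fun Z : Finset (TorusSite d L × κ) => V Z ≠ 0 ∧ y ∈ Z) ≤
        2 ^ ((2 * r + 1) ^ d * Fintype.card κ) := by
    intro y _
    -- all such `Z` lie in the powerset of `b_y(r)`
    have hsub : (univ.filter fun Z : Finset (TorusSite d L × κ) => V Z ≠ 0 ∧ y ∈ Z) ⊆
        (cellBall y.1 r : Finset (TorusSite d L × κ)).powerset := by
      intro Z hZ
      simp only [mem_filter, mem_univ, true_and] at hZ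
      have hdiam : torusDiam Z ≤ r := by
        by_contra h
        exact hZ.1 (hVr Z (not_le.mp h))
      exact mem_powerset.mpr fun z hz =>
        mem_cellBall_iff.2 ((torusDist_le_torusDiam hZ.2 hz).trans hdiam)
    calc #(univ.filter fun Z : Finset (TorusSite d L × κ) => V Z ≠ 0 ∧ y ∈ Z)
        ≤ #((cellBall y.1 r : Finset (TorusSite d L × κ)).powerset) := card_le_card hsub
      _ = 2 ^ #(cellBall y.1 r : Finset (TorusSite d L × κ)) := card_powerset _
      _ ≤ 2 ^ ((2 * r + 1) ^ d * Fintype.card κ) :=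
          Nat.pow_le_pow_right (by norm_num) (card_cellBall_le y.1 r)
  calc ∑ y ∈ (cellBall x R' : Finset (TorusSite d L × κ)),
        #(univ.filter fun Z : Finset (TorusSite d L × κ) => V Z ≠ 0 ∧ y ∈ Z)
      ≤ ∑ y ∈ (cellBall x R' : Finset (TorusSite d L × κ)), 2 ^ ((2 * r + 1) ^ d * Fintype.card κ) :=
        sum_le_sum hy
    _ = _ := by rw [sum_const, smul_eq_mul]

/-- **The light-cone sum restricted to the terms beyond a ball (combinatorial form).** As
`sum_norm_comm_heisenbergEvolution_le`, but summing only over the terms `Z` disjoint from the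
balls `b_x(R+n')`, `n' < m`: only the classes `n ≥ m` contribute.

Original statement: **The light-cone sum over the terms of a finite-range perturbation (combinatorial form).**
Let the dynamics be generated by a local interaction `Φ` of range `r₀` with the Lieb–Robinson
data `(J, V)` of `norm_comm_heisenbergEvolution_ball_le`, let `W` be a local interaction of
range `r` with `‖W Z‖ ≤ 1`, and `O ∈ 𝔄_{b_x(R)}`. Grouping the terms `Z` by the first ball
`b_x(R+n)` they meet and using the Lieb–Robinson bound for the classes `n ≥ r₀ + 1`:
`Σ_Z ‖[W Z, τ_t(O)]‖ ≤ 2‖O‖ (1 + 2^{(2r+1)^d|κ|} Σ_{n ≤ L} |b_x(R+n)| g n)`,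
`g n = min 1 ((|b_x(R)|/V) exp(−μ⌊n/(r₀+1)⌋ + 2e^μ V J |t|))` for `n ≥ r₀+1` and `g n = 1`
otherwise. MZ13 §5.1, proof of Lemma 1 (v) (arXiv:1109.1588 p. 11). [folklore] -/
theorem sum_filter_norm_comm_heisenbergEvolution_le {Φ : Interaction (TorusSite d L × κ) q}
    (hΦ : Φ.IsLocal) {r₀ : ℕ} (hrange : ∀ Z, r₀ < torusDiam Z → Φ Z = 0)
    {J : ℝ} (hJ0 : 0 ≤ J)
    (hJ : ∀ y : TorusSite d L × κ, ∑ Z ∈ univ.filter (fun Z : Finset (TorusSite d L × κ) => y ∈ Z),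
      ‖Φ Z‖ ≤ J)
    {V : ℕ} (hV1 : 1 ≤ V) (hV : ∀ Z, Φ Z ≠ 0 → #Z ≤ V)
    {W : Interaction (TorusSite d L × κ) q} (hW : W.IsLocal) {r : ℕ}
    (hWr : ∀ Z, r < torusDiam Z → W Z = 0) (hW1 : ∀ Z, ‖W Z‖ ≤ 1)
    (x : TorusSite d L) {R : ℕ} {O : Op (TorusSite d L × κ) q} (hO : IsSupportedOn O (cellBall x R))
    {μ : ℝ} (hμ : 0 ≤ μ) (t : ℝ) (m : ℕ) :
    ∑ Z ∈ univ.filter (fun Z : Finset (TorusSite d L × κ) =>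
        ∀ n' < m, Disjoint Z (cellBall x (R + n'))),
        ‖W Z * heisenbergEvolution (localHamiltonian Φ univ) t O -
          heisenbergEvolution (localHamiltonian Φ univ) t O * W Z‖ ≤
      2 * ‖O‖ * (1 + 2 ^ ((2 * r + 1) ^ d * Fintype.card κ) *
        ∑ n ∈ range (L + 1), (if m ≤ n then (#(cellBall x (R + n) : Finset (TorusSite d L × κ)) : ℝ) *
          (if r₀ + 1 ≤ n then min 1 ((#(cellBall x R : Finset (TorusSite d L × κ)) / V : ℝ) *
            Real.exp (-(μ * ((n / (r₀ + 1) : ℕ) : ℝ)) + 2 * Real.exp μ * V * J * |t|)) else 1) else 0)) := by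
  set τO : Op (TorusSite d L × κ) q := heisenbergEvolution (localHamiltonian Φ univ) t O with hτO
  set f : Finset (TorusSite d L × κ) → ℝ := fun Z => ‖W Z * τO - τO * W Z‖ with hf
  set g : ℕ → ℝ := fun n => if r₀ + 1 ≤ n then min 1 ((#(cellBall x R : Finset (TorusSite d L × κ)) / V : ℝ) *
    Real.exp (-(μ * ((n / (r₀ + 1) : ℕ) : ℝ)) + 2 * Real.exp μ * V * J * |t|)) else 1 with hg
  have hg0 : ∀ n, 0 ≤ g n := fun n => by
    simp only [hg]; split_ifs
    · exact le_min zero_le_one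
        (mul_nonneg (div_nonneg (Nat.cast_nonneg _) (Nat.cast_nonneg _)) (Real.exp_pos _).le)
    · exact zero_le_one
  have hg1 : ∀ n, g n ≤ 1 := fun n => by
    simp only [hg]; split_ifs
    · exact min_le_left _ _
    · exact le_rfl
  have hO0 := norm_nonneg O
  have hH : (localHamiltonian Φ univ).IsHermitian := localHamiltonian_isHermitian hΦ univ
  have hτO_norm : ‖τO‖ = ‖O‖ := norm_heisenbergEvolution_holds hH t O
  -- the trivial bound for every term
  have htriv : ∀ Z, f Z ≤ 2 * ‖O‖ * ‖W Z‖ := fun Z => by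
    calc f Z ≤ ‖W Z * τO‖ + ‖τO * W Z‖ := norm_sub_le _ _
      _ ≤ ‖W Z‖ * ‖τO‖ + ‖τO‖ * ‖W Z‖ := add_le_add (norm_mul_le _ _) (norm_mul_le _ _)
      _ = 2 * ‖O‖ * ‖W Z‖ := by rw [hτO_norm]; ring
  -- the class of a term: the first `n` with `Z ∩ b_x(R+n) ≠ ∅`; indicator of the class
  set cls : Finset (TorusSite d L × κ) → ℕ → Prop := fun Z n =>
    ¬ Disjoint Z (cellBall x (R + n)) ∧ ∀ n' < n, Disjoint Z (cellBall x (R + n')) with hcls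
  -- every nonempty `Z` has exactly one class `≤ L`
  have hcls_ex : ∀ Z : Finset (TorusSite d L × κ), Z.Nonempty → ∃ n ∈ range (L + 1), cls Z n := by
    intro Z hZ
    have huniv : ¬ Disjoint Z (cellBall x (R + L) : Finset (TorusSite d L × κ)) := by
      rw [cellBall_eq_univ (x := x) (by omega)]
      obtain ⟨y, hy⟩ := hZ
      exact not_disjoint_iff.mpr ⟨y, hy, mem_univ y⟩
    have hex : ∃ n, ¬ Disjoint Z (cellBall x (R + n) : Finset (TorusSite d L × κ)) := ⟨L, huniv⟩
    classical
    refine ⟨Nat.find hex, ?_, Nat.find_spec hex, fun n' hn' => ?_⟩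
    · rw [mem_range]
      have : Nat.find hex ≤ L := Nat.find_min' hex huniv
      omega
    · have := Nat.find_min hex hn'
      simpa using this
  have hcls_uniq : ∀ Z n₁ n₂, cls Z n₁ → cls Z n₂ → n₁ = n₂ := by
    intro Z n₁ n₂ h₁ h₂
    by_contra hne
    rcases Nat.lt_or_gt_of_ne hne with h | h
    · exact h₁.1 (h₂.2 n₁ h)
    · exact h₂.1 (h₁.2 n₂ h)
  -- the bound on a term of class `n`
  have hclass : ∀ Z n, W Z ≠ 0 → cls Z n → f Z ≤ 2 * ‖O‖ * g n := by
    intro Z n hZ hn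
    have hW1Z := hW1 Z
    by_cases hn1 : r₀ + 1 ≤ n
    · simp only [hg, if_pos hn1]
      rw [mul_min_of_nonneg _ _ (mul_nonneg zero_le_two hO0)]
      refine le_min ?_ ?_
      · -- trivial part
        calc f Z ≤ 2 * ‖O‖ * ‖W Z‖ := htriv Z
          _ ≤ 2 * ‖O‖ * 1 := mul_le_mul_of_nonneg_left hW1Z (mul_nonneg zero_le_two hO0)
      · -- Lieb–Robinson part: `Z` is disjoint from `b_x(R + (n-1))`
        have hdisj : Disjoint (cellBall x (R + (n - 1)) : Finset (TorusSite d L × κ)) Z :=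
          (hn.2 (n - 1) (by omega)).symm
        have hℓ : r₀ ≤ n - 1 := by omega
        have h := norm_comm_heisenbergEvolution_ball_le hΦ hrange hJ0 hJ hV1 hV x hℓ hO hdisj
          (hW.isSupportedOn Z) hμ t
        -- `‖[τO, WZ]‖ = ‖[WZ, τO]‖`
        have hsymm : f Z = ‖τO * W Z - W Z * τO‖ := by
          simp only [hf]; rw [← norm_neg]; congr 1; abel
        have hn' : n - 1 + 1 = n := by omega
        rw [hsymm]
        refine h.trans ?_
        rw [hn']
        calc 2 * ‖O‖ * ‖W Z‖ * ((#(cellBall x R : Finset (TorusSite d L × κ)) : ℝ) / V) *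
              Real.exp (-(μ * ((n / (r₀ + 1) : ℕ) : ℝ)) + 2 * Real.exp μ * V * J * |t|)
            ≤ 2 * ‖O‖ * 1 * ((#(cellBall x R : Finset (TorusSite d L × κ)) : ℝ) / V) *
              Real.exp (-(μ * ((n / (r₀ + 1) : ℕ) : ℝ)) + 2 * Real.exp μ * V * J * |t|) := by
              have : 0 ≤ ((#(cellBall x R : Finset (TorusSite d L × κ)) : ℝ) / V) *
                  Real.exp (-(μ * ((n / (r₀ + 1) : ℕ) : ℝ)) + 2 * Real.exp μ * V * J * |t|) :=
                mul_nonneg (div_nonneg (Nat.cast_nonneg _) (Nat.cast_nonneg _)) (Real.exp_pos _).le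
              have h2 : 2 * ‖O‖ * ‖W Z‖ ≤ 2 * ‖O‖ * 1 :=
                mul_le_mul_of_nonneg_left hW1Z (mul_nonneg zero_le_two hO0)
              calc _ = (2 * ‖O‖ * ‖W Z‖) * (((#(cellBall x R : Finset (TorusSite d L × κ)) : ℝ) / V) *
                    Real.exp (-(μ * ((n / (r₀ + 1) : ℕ) : ℝ)) + 2 * Real.exp μ * V * J * |t|)) := by ring
                _ ≤ (2 * ‖O‖ * 1) * (((#(cellBall x R : Finset (TorusSite d L × κ)) : ℝ) / V) *
                    Real.exp (-(μ * ((n / (r₀ + 1) : ℕ) : ℝ)) + 2 * Real.exp μ * V * J * |t|)) :=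
                    mul_le_mul_of_nonneg_right h2 this
                _ = _ := by ring
          _ = 2 * ‖O‖ * (((#(cellBall x R : Finset (TorusSite d L × κ)) : ℝ) / V) *
              Real.exp (-(μ * ((n / (r₀ + 1) : ℕ) : ℝ)) + 2 * Real.exp μ * V * J * |t|)) := by ring
    · simp only [hg, if_neg hn1]
      calc f Z ≤ 2 * ‖O‖ * ‖W Z‖ := htriv Z
        _ ≤ 2 * ‖O‖ * 1 := mul_le_mul_of_nonneg_left hW1Z (mul_nonneg zero_le_two hO0)
  -- pointwise, for nonempty `Z`: `f Z ≤ 2‖O‖ Σ_n [W Z ≠ 0 ∧ cls Z n] g n`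
  classical
  have hpt : ∀ Z : Finset (TorusSite d L × κ), Z.Nonempty → f Z ≤
      2 * ‖O‖ * ∑ n ∈ range (L + 1), (if W Z ≠ 0 ∧ cls Z n then g n else 0) := by
    intro Z hZne
    have hterm0 : ∀ n, 0 ≤ (if W Z ≠ 0 ∧ cls Z n then g n else 0) := fun n => by
      split_ifs
      · exact hg0 n
      · exact le_rfl
    have hsum0 : 0 ≤ ∑ n ∈ range (L + 1), (if W Z ≠ 0 ∧ cls Z n then g n else 0) :=
      sum_nonneg fun n _ => hterm0 n
    by_cases hZ0 : W Z = 0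
    · have : f Z = 0 := by simp only [hf, hZ0, zero_mul, mul_zero, sub_zero, norm_zero]
      rw [this]
      exact mul_nonneg (mul_nonneg zero_le_two hO0) hsum0
    · obtain ⟨n, hn, hcn⟩ := hcls_ex Z hZne
      have hsingle : (if W Z ≠ 0 ∧ cls Z n then g n else 0) ≤
          ∑ n' ∈ range (L + 1), (if W Z ≠ 0 ∧ cls Z n' then g n' else 0) :=
        single_le_sum (f := fun n' => (if W Z ≠ 0 ∧ cls Z n' then g n' else 0))
          (fun n' _ => hterm0 n') hn
      rw [if_pos ⟨hZ0, hcn⟩] at hsingle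
      exact (hclass Z n hZ0 hcn).trans (mul_le_mul_of_nonneg_left hsingle (mul_nonneg zero_le_two hO0))
  -- the admissible terms and their classes
  set Pm : Finset (TorusSite d L × κ) → Prop := fun Z => ∀ n' < m, Disjoint Z (cellBall x (R + n')) with hPm
  have hPcls : ∀ Z n, Pm Z → cls Z n → m ≤ n := by
    intro Z n hP hc
    by_contra h
    exact hc.1 (hP n (not_le.mp h))
  set S : Finset (Finset (TorusSite d L × κ)) := univ.filter Pm with hSdef
  have hempS : (∅ : Finset (TorusSite d L × κ)) ∈ S := by
    simp only [hSdef, mem_filter, mem_univ, true_and, hPm]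
    exact fun n' _ => disjoint_empty_left _
  -- split off the empty region, sum over `Z` and exchange
  rw [← Finset.add_sum_erase S f hempS]
  have hempty : f ∅ ≤ 2 * ‖O‖ * 1 :=
    (htriv ∅).trans (mul_le_mul_of_nonneg_left (hW1 ∅) (mul_nonneg zero_le_two hO0))
  have hind0 : ∀ Z n, 0 ≤ (if W Z ≠ 0 ∧ cls Z n then g n else 0) := fun Z n => by
    split_ifs
    · exact hg0 n
    · exact le_rfl
  have hrest : ∑ Z ∈ S.erase ∅, f Z ≤
      2 * ‖O‖ * (2 ^ ((2 * r + 1) ^ d * Fintype.card κ) *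
        ∑ n ∈ range (L + 1), (if m ≤ n then
          (#(cellBall x (R + n) : Finset (TorusSite d L × κ)) : ℝ) * g n else 0)) := by
    calc ∑ Z ∈ S.erase ∅, f Z
        ≤ ∑ Z ∈ S.erase ∅, 2 * ‖O‖ * ∑ n ∈ range (L + 1),
            (if m ≤ n then (if W Z ≠ 0 ∧ cls Z n then g n else 0) else 0) := by
          refine sum_le_sum fun Z hZ => ?_
          have hZne : Z.Nonempty := Finset.nonempty_iff_ne_empty.mpr (Finset.ne_of_mem_erase hZ)
          have hZP : Pm Z := by
            have := Finset.mem_of_mem_erase hZ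
            simp only [hSdef, mem_filter, mem_univ, true_and] at this
            exact this
          refine (hpt Z hZne).trans (mul_le_mul_of_nonneg_left (sum_le_sum fun n _ => ?_)
            (mul_nonneg zero_le_two hO0))
          by_cases hmn : m ≤ n
          · rw [if_pos hmn]
          · rw [if_neg hmn]
            split_ifs with hc
            · exact absurd (hPcls Z n hZP hc.2) hmn
            · exact le_rfl
      _ ≤ ∑ Z : Finset (TorusSite d L × κ), 2 * ‖O‖ * ∑ n ∈ range (L + 1),
            (if m ≤ n then (if W Z ≠ 0 ∧ cls Z n then g n else 0) else 0) := by
          refine sum_le_sum_of_subset_of_nonneg (fun Z hZ => mem_univ Z) fun Z _ _ => ?_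
          refine mul_nonneg (mul_nonneg zero_le_two hO0) (sum_nonneg fun n _ => ?_)
          split_ifs
          · exact hg0 n
          · exact le_rfl
          · exact le_rfl
      _ = 2 * ‖O‖ * ∑ n ∈ range (L + 1), ∑ Z : Finset (TorusSite d L × κ),
            (if m ≤ n then (if W Z ≠ 0 ∧ cls Z n then g n else 0) else 0) := by rw [← mul_sum, sum_comm]
      _ ≤ 2 * ‖O‖ * (2 ^ ((2 * r + 1) ^ d * Fintype.card κ) *
            ∑ n ∈ range (L + 1), (if m ≤ n then
              (#(cellBall x (R + n) : Finset (TorusSite d L × κ)) : ℝ) * g n else 0)) := by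
          refine mul_le_mul_of_nonneg_left ?_ (mul_nonneg zero_le_two hO0)
          rw [mul_sum]
          refine sum_le_sum fun n _ => ?_
          by_cases hmn : m ≤ n
          · simp only [if_pos hmn]
            rw [← sum_filter, sum_const, nsmul_eq_mul]
            have hcard : (#(univ.filter fun Z : Finset (TorusSite d L × κ) => W Z ≠ 0 ∧ cls Z n) : ℝ) ≤
                #(cellBall x (R + n) : Finset (TorusSite d L × κ)) * 2 ^ ((2 * r + 1) ^ d * Fintype.card κ) := by
              have h1 : (univ.filter fun Z : Finset (TorusSite d L × κ) => W Z ≠ 0 ∧ cls Z n) ⊆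
                  univ.filter fun Z : Finset (TorusSite d L × κ) =>
                    W Z ≠ 0 ∧ ¬ Disjoint Z (cellBall x (R + n)) := by
                intro Z hZ
                simp only [mem_filter, mem_univ, true_and] at hZ ⊢
                exact ⟨hZ.1, hZ.2.1⟩
              have h2 := card_filter_not_disjoint_cellBall_le (V := W) hWr x (R + n)
              exact_mod_cast (card_le_card h1).trans h2
            calc (#(univ.filter fun Z : Finset (TorusSite d L × κ) => W Z ≠ 0 ∧ cls Z n) : ℝ) * g n
                ≤ (#(cellBall x (R + n) : Finset (TorusSite d L × κ)) *
                    2 ^ ((2 * r + 1) ^ d * Fintype.card κ)) * g n :=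
                  mul_le_mul_of_nonneg_right hcard (hg0 n)
              _ = 2 ^ ((2 * r + 1) ^ d * Fintype.card κ) *
                  ((#(cellBall x (R + n) : Finset (TorusSite d L × κ)) : ℝ) * g n) := by ring
          · simp only [if_neg hmn, sum_const_zero, mul_zero]
            exact le_rfl
  calc f ∅ + ∑ Z ∈ S.erase ∅, f Z
      ≤ 2 * ‖O‖ * 1 + 2 * ‖O‖ * (2 ^ ((2 * r + 1) ^ d * Fintype.card κ) *
        ∑ n ∈ range (L + 1), (if m ≤ n then
          (#(cellBall x (R + n) : Finset (TorusSite d L × κ)) : ℝ) * g n else 0)) :=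
        add_le_add hempty hrest
    _ = _ := by ring

/-- **The light-cone sum over the terms of a finite-range perturbation (combinatorial form).**
Let the dynamics be generated by a local interaction `Φ` of range `r₀` with the Lieb–Robinson
data `(J, V)` of `norm_comm_heisenbergEvolution_ball_le`, let `W` be a local interaction of
range `r` with `‖W Z‖ ≤ 1`, and `O ∈ 𝔄_{b_x(R)}`. Grouping the terms `Z` by the first ball
`b_x(R+n)` they meet and using the Lieb–Robinson bound for the classes `n ≥ r₀ + 1`:
`Σ_Z ‖[W Z, τ_t(O)]‖ ≤ 2‖O‖ (1 + 2^{(2r+1)^d|κ|} Σ_{n ≤ L} |b_x(R+n)| g n)`,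
`g n = min 1 ((|b_x(R)|/V) exp(−μ⌊n/(r₀+1)⌋ + 2e^μ V J |t|))` for `n ≥ r₀+1` and `g n = 1`
otherwise. MZ13 §5.1, proof of Lemma 1 (v) (arXiv:1109.1588 p. 11). [folklore] -/
theorem sum_norm_comm_heisenbergEvolution_le {Φ : Interaction (TorusSite d L × κ) q}
    (hΦ : Φ.IsLocal) {r₀ : ℕ} (hrange : ∀ Z, r₀ < torusDiam Z → Φ Z = 0)
    {J : ℝ} (hJ0 : 0 ≤ J)
    (hJ : ∀ y : TorusSite d L × κ, ∑ Z ∈ univ.filter (fun Z : Finset (TorusSite d L × κ) => y ∈ Z),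
      ‖Φ Z‖ ≤ J)
    {V : ℕ} (hV1 : 1 ≤ V) (hV : ∀ Z, Φ Z ≠ 0 → #Z ≤ V)
    {W : Interaction (TorusSite d L × κ) q} (hW : W.IsLocal) {r : ℕ}
    (hWr : ∀ Z, r < torusDiam Z → W Z = 0) (hW1 : ∀ Z, ‖W Z‖ ≤ 1)
    (x : TorusSite d L) {R : ℕ} {O : Op (TorusSite d L × κ) q} (hO : IsSupportedOn O (cellBall x R))
    {μ : ℝ} (hμ : 0 ≤ μ) (t : ℝ) :
    ∑ Z : Finset (TorusSite d L × κ),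
        ‖W Z * heisenbergEvolution (localHamiltonian Φ univ) t O -
          heisenbergEvolution (localHamiltonian Φ univ) t O * W Z‖ ≤
      2 * ‖O‖ * (1 + 2 ^ ((2 * r + 1) ^ d * Fintype.card κ) *
        ∑ n ∈ range (L + 1), (#(cellBall x (R + n) : Finset (TorusSite d L × κ)) : ℝ) *
          (if r₀ + 1 ≤ n then min 1 ((#(cellBall x R : Finset (TorusSite d L × κ)) / V : ℝ) *
            Real.exp (-(μ * ((n / (r₀ + 1) : ℕ) : ℝ)) + 2 * Real.exp μ * V * J * |t|)) else 1)) := by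
  have h := sum_filter_norm_comm_heisenbergEvolution_le hΦ hrange hJ0 hJ hV1 hV hW hWr hW1 x hO hμ t 0
  rw [Finset.filter_true_of_mem (fun Z _ n' hn' => absurd hn' (Nat.not_lt_zero n'))] at h
  refine h.trans (le_of_eq ?_)
  simp only [Nat.zero_le, if_true]

end LightCone

section LCEval

/-- Geometric tail: `Σ_{j ∈ s} e^{−b j} ≤ 1/b` over any finite set of POSITIVE integers, `b > 0`
(`Σ_{j ≥ 1} q^j = q/(1−q) = 1/(e^b − 1) ≤ 1/b`). [folklore] -/
theorem sum_exp_neg_mul_le {b : ℝ} (hb : 0 < b) (s : Finset ℕ) (hs : ∀ j ∈ s, 1 ≤ j) :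
    ∑ j ∈ s, Real.exp (-(b * j)) ≤ 1 / b := by
  -- compare with the geometric series `Σ_{j < N+1} q^j - 1`
  obtain ⟨N, hN⟩ : ∃ N, ∀ j ∈ s, j ≤ N := ⟨s.sup id, fun j hj => le_sup (f := id) hj⟩
  set q : ℝ := Real.exp (-b) with hq
  have hq0 : 0 ≤ q := (Real.exp_pos _).le
  have hq1 : q < 1 := by
    rw [hq]; exact (Real.exp_lt_exp.mpr (by linarith : -b < 0)).trans_eq Real.exp_zero
  have hterm : ∀ j : ℕ, Real.exp (-(b * j)) = q ^ j := fun j => by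
    rw [hq, ← Real.exp_nat_mul]; congr 1; ring
  have h1 : ∑ j ∈ s, Real.exp (-(b * j)) ≤ ∑ j ∈ Finset.Ico 1 (N + 1), q ^ j := by
    rw [show ∑ j ∈ s, Real.exp (-(b * j)) = ∑ j ∈ s, q ^ j from sum_congr rfl fun j _ => hterm j]
    refine sum_le_sum_of_subset_of_nonneg (fun j hj => ?_) fun j _ _ => pow_nonneg hq0 j
    exact Finset.mem_Ico.mpr ⟨hs j hj, Nat.lt_succ_of_le (hN j hj)⟩
  refine h1.trans ?_
  -- `Σ_{1 ≤ j ≤ N} q^j = q (1 - q^N)/(1-q) ≤ q/(1-q) ≤ 1/b`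
  have h2 : ∑ j ∈ Finset.Ico 1 (N + 1), q ^ j ≤ q / (1 - q) := by
    have h1q0 : 0 < 1 - q := by linarith
    have hgeom : ∑ j ∈ Finset.range N, q ^ j ≤ 1 / (1 - q) := by
      have hmul : (∑ j ∈ Finset.range N, q ^ j) * (1 - q) = 1 - q ^ N := geom_sum_mul_neg q N
      rw [le_div_iff₀ h1q0, hmul]
      have : 0 ≤ q ^ N := pow_nonneg hq0 N
      linarith
    have hshift : ∑ j ∈ Finset.Ico 1 (N + 1), q ^ j = q * ∑ j ∈ Finset.range N, q ^ j := by
      rw [Finset.mul_sum, Finset.sum_Ico_eq_sum_range, Nat.add_sub_cancel]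
      refine sum_congr rfl fun j _ => ?_
      rw [pow_add, pow_one, mul_comm]
    rw [hshift]
    calc q * ∑ j ∈ Finset.range N, q ^ j ≤ q * (1 / (1 - q)) := mul_le_mul_of_nonneg_left hgeom hq0
      _ = q / (1 - q) := by ring
  refine h2.trans ?_
  -- `q/(1-q) = 1/(e^b - 1) ≤ 1/b`
  have hexp : b ≤ Real.exp b - 1 := by linarith [Real.add_one_le_exp b]
  have hpos : 0 < Real.exp b - 1 := lt_of_lt_of_le hb hexp
  have hq' : q = (Real.exp b)⁻¹ := by rw [hq, Real.exp_neg]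
  have h1q : 1 - q = (Real.exp b - 1) / Real.exp b := by
    rw [hq']; field_simp
  rw [h1q, hq', div_div_eq_mul_div, inv_mul_cancel₀ (Real.exp_pos b).ne']
  exact one_div_le_one_div_of_le hb hexp

/-- Polynomial times exponential: `(1 + 2j)^d e^{−a j} ≤ d! (6/a)^d e^{−a j/2}` for `j ≥ 1`,
`a > 0`. [folklore] -/
theorem pow_mul_exp_neg_le {a : ℝ} (ha : 0 < a) (d : ℕ) {j : ℕ} (hj : 1 ≤ j) :
    (1 + 2 * (j : ℝ)) ^ d * Real.exp (-(a * j)) ≤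
      (Nat.factorial d : ℝ) * (6 / a) ^ d * Real.exp (-(a / 2 * j)) := by
  have hj' : (1 : ℝ) ≤ j := by exact_mod_cast hj
  have hx : 0 < a * j / 2 := by positivity
  -- `e^{-aj/2} ≤ d!/(aj/2)^d`
  have h1 := exp_neg_le_factorial_div_pow hx d
  have hsplit : Real.exp (-(a * j)) = Real.exp (-(a * j / 2)) * Real.exp (-(a / 2 * j)) := by
    rw [← Real.exp_add]; congr 1; ring
  rw [hsplit, ← mul_assoc]
  refine mul_le_mul_of_nonneg_right ?_ (Real.exp_pos _).le
  calc (1 + 2 * (j : ℝ)) ^ d * Real.exp (-(a * j / 2))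
      ≤ (1 + 2 * (j : ℝ)) ^ d * ((Nat.factorial d : ℝ) / (a * j / 2) ^ d) :=
        mul_le_mul_of_nonneg_left h1 (by positivity)
    _ = (Nat.factorial d : ℝ) * ((1 + 2 * (j : ℝ)) / (a * j / 2)) ^ d := by
        rw [div_pow (1 + 2 * (j : ℝ))]; ring
    _ ≤ (Nat.factorial d : ℝ) * (6 / a) ^ d := by
        refine mul_le_mul_of_nonneg_left (pow_le_pow_left₀ (by positivity) ?_ d) (by positivity)
        rw [div_le_div_iff₀ hx ha]
        nlinarith

/-- **Polynomial growth of the light-cone sum.** For `a > 0`, `C₁ ≥ 0`, `τ ≥ 0` and the cut-off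
index `n⋆ = ⌈(τ + max 0 (log C₁))/a⌉₊`:
`Σ_{n ≤ M} (2(R+n)+1)^d min(1, C₁ e^{−a n + τ}) ≤ (2(R+n⋆)+1)^d (n⋆ + 1 + d! (6/a)^d (2/a))`.
[folklore] -/
theorem sum_pow_mul_min_exp_le {a : ℝ} (ha : 0 < a) {C₁ τ : ℝ} (hC₁ : 0 ≤ C₁) (R d M : ℕ) :
    ∑ n ∈ range (M + 1), (2 * ((R : ℝ) + n) + 1) ^ d * min 1 (C₁ * Real.exp (-(a * n) + τ)) ≤
      (2 * ((R : ℝ) + ⌈(τ + max 0 (Real.log C₁)) / a⌉₊) + 1) ^ d *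
        ((⌈(τ + max 0 (Real.log C₁)) / a⌉₊ : ℝ) + 1 + (Nat.factorial d : ℝ) * (6 / a) ^ d * (2 / a)) := by
  set ns : ℕ := ⌈(τ + max 0 (Real.log C₁)) / a⌉₊ with hns
  set A : ℝ := 2 * ((R : ℝ) + ns) + 1 with hA
  have hA1 : 1 ≤ A := by rw [hA]; have := (Nat.cast_nonneg ns : (0:ℝ) ≤ ns); have := (Nat.cast_nonneg R : (0:ℝ) ≤ R); linarith
  have hA0 : 0 ≤ A := zero_le_one.trans hA1
  -- key: for `n > ns`, `C₁ e^{-a n + τ} ≤ e^{-a (n - ns)}`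
  have hkey : ∀ n : ℕ, ns < n → C₁ * Real.exp (-(a * n) + τ) ≤ Real.exp (-(a * ((n : ℝ) - ns))) := by
    intro n hn
    rcases hC₁.eq_or_lt with h0 | hC₁pos
    · rw [← h0, zero_mul]; exact (Real.exp_pos _).le
    · have hceil : (τ + max 0 (Real.log C₁)) / a ≤ ns := Nat.le_ceil _
      have h1 : τ + Real.log C₁ ≤ a * ns := by
        rw [div_le_iff₀ ha] at hceil
        have := le_max_right 0 (Real.log C₁)
        linarith
      calc C₁ * Real.exp (-(a * n) + τ) = Real.exp (Real.log C₁ + (-(a * n) + τ)) := by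
            rw [Real.exp_add (Real.log C₁), Real.exp_log hC₁pos]
        _ ≤ Real.exp (-(a * ((n : ℝ) - ns))) := by
            rw [Real.exp_le_exp]; nlinarith
  -- split the sum at `ns`
  have hsplit : ∀ n ∈ range (M + 1),
      (2 * ((R : ℝ) + n) + 1) ^ d * min 1 (C₁ * Real.exp (-(a * n) + τ)) ≤
        (if n ≤ ns then A ^ d else 0) +
        (if ns < n then A ^ d * ((1 + 2 * (((n - ns : ℕ) : ℝ))) ^ d * Real.exp (-(a * ((n - ns : ℕ) : ℝ)))) else 0) := by
    intro n _
    by_cases hn : n ≤ ns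
    · rw [if_pos hn, if_neg (not_lt.mpr hn), add_zero]
      have hn' : (n : ℝ) ≤ ns := by exact_mod_cast hn
      calc (2 * ((R : ℝ) + n) + 1) ^ d * min 1 (C₁ * Real.exp (-(a * n) + τ))
          ≤ (2 * ((R : ℝ) + n) + 1) ^ d * 1 :=
            mul_le_mul_of_nonneg_left (min_le_left _ _) (by positivity)
        _ ≤ A ^ d := by
            rw [mul_one]; exact pow_le_pow_left₀ (by positivity) (by rw [hA]; linarith) d
    · rw [if_neg hn, if_pos (not_le.mp hn), zero_add]
      have hlt := not_le.mp hn
      have hcast : (((n - ns : ℕ) : ℝ)) = (n : ℝ) - ns := by push_cast [Nat.cast_sub hlt.le]; ring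
      have hj1 : (1 : ℝ) ≤ ((n - ns : ℕ) : ℝ) := by exact_mod_cast (Nat.le_sub_of_add_le' hlt : 1 ≤ n - ns)
      -- `(2(R+n)+1) ≤ A (1 + 2(n-ns))`
      have hbase : 2 * ((R : ℝ) + n) + 1 ≤ A * (1 + 2 * ((n - ns : ℕ) : ℝ)) := by
        rw [hcast, hA]
        have := (Nat.cast_nonneg ns : (0:ℝ) ≤ ns); have := (Nat.cast_nonneg R : (0:ℝ) ≤ R)
        have hnns : (ns : ℝ) ≤ n := by exact_mod_cast hlt.le
        nlinarith
      calc (2 * ((R : ℝ) + n) + 1) ^ d * min 1 (C₁ * Real.exp (-(a * n) + τ))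
          ≤ (A * (1 + 2 * ((n - ns : ℕ) : ℝ))) ^ d * Real.exp (-(a * ((n : ℝ) - ns))) :=
            mul_le_mul (pow_le_pow_left₀ (by positivity) hbase d) ((min_le_right _ _).trans (hkey n hlt))
              (le_min zero_le_one (mul_nonneg hC₁ (Real.exp_pos _).le)) (by positivity)
        _ = A ^ d * ((1 + 2 * ((n - ns : ℕ) : ℝ)) ^ d * Real.exp (-(a * ((n - ns : ℕ) : ℝ)))) := by
            rw [mul_pow, hcast]; ring
  refine (sum_le_sum hsplit).trans ?_
  rw [sum_add_distrib]
  -- first part: at most `ns + 1` terms equal to `A^d`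
  have hpart1 : ∑ n ∈ range (M + 1), (if n ≤ ns then A ^ d else 0) ≤ ((ns : ℝ) + 1) * A ^ d := by
    rw [← sum_filter]
    rw [sum_const, nsmul_eq_mul]
    refine mul_le_mul_of_nonneg_right ?_ (by positivity)
    have : (range (M + 1)).filter (fun n => n ≤ ns) ⊆ range (ns + 1) := by
      intro n hn; simp only [mem_filter, mem_range] at hn ⊢; omega
    calc ((#((range (M + 1)).filter (fun n => n ≤ ns)) : ℕ) : ℝ) ≤ ((#(range (ns + 1)) : ℕ) : ℝ) := by
          exact_mod_cast card_le_card this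
      _ = (ns : ℝ) + 1 := by rw [card_range]; push_cast; ring
  -- second part: reindex by `j = n - ns ≥ 1` and use the two analytic lemmas
  have hpart2 : ∑ n ∈ range (M + 1), (if ns < n then A ^ d * ((1 + 2 * (((n - ns : ℕ) : ℝ))) ^ d *
      Real.exp (-(a * ((n - ns : ℕ) : ℝ)))) else 0) ≤
      A ^ d * ((Nat.factorial d : ℝ) * (6 / a) ^ d * (2 / a)) := by
    rw [← sum_filter]
    -- the map `n ↦ n - ns` is injective on the filter and lands in positive integers
    have hinj : Set.InjOn (fun n => n - ns) ((range (M + 1)).filter (fun n => ns < n) : Set ℕ) := by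
      intro n₁ h₁ n₂ h₂ h
      simp only [coe_filter, mem_range, Set.mem_setOf_eq] at h₁ h₂
      have : n₁ - ns = n₂ - ns := h
      omega
    rw [← sum_image (f := fun j : ℕ => A ^ d * ((1 + 2 * (j : ℝ)) ^ d * Real.exp (-(a * (j : ℝ))))) hinj]
    rw [← mul_sum]
    refine mul_le_mul_of_nonneg_left ?_ (by positivity)
    have himg : ∀ j ∈ ((range (M + 1)).filter (fun n => ns < n)).image (fun n => n - ns), 1 ≤ j := by
      intro j hj
      simp only [mem_image, mem_filter, mem_range] at hj
      obtain ⟨n, ⟨_, hn⟩, rfl⟩ := hj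
      omega
    calc ∑ j ∈ ((range (M + 1)).filter (fun n => ns < n)).image (fun n => n - ns),
          (1 + 2 * (j : ℝ)) ^ d * Real.exp (-(a * (j : ℝ)))
        ≤ ∑ j ∈ ((range (M + 1)).filter (fun n => ns < n)).image (fun n => n - ns),
          (Nat.factorial d : ℝ) * (6 / a) ^ d * Real.exp (-(a / 2 * j)) :=
          sum_le_sum fun j hj => pow_mul_exp_neg_le ha d (himg j hj)
      _ = (Nat.factorial d : ℝ) * (6 / a) ^ d *
          ∑ j ∈ ((range (M + 1)).filter (fun n => ns < n)).image (fun n => n - ns),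
            Real.exp (-(a / 2 * j)) := by rw [mul_sum]
      _ ≤ (Nat.factorial d : ℝ) * (6 / a) ^ d * (1 / (a / 2)) :=
          mul_le_mul_of_nonneg_left (sum_exp_neg_mul_le (half_pos ha) _ himg) (by positivity)
      _ = (Nat.factorial d : ℝ) * (6 / a) ^ d * (2 / a) := by congr 1; field_simp
  calc ∑ n ∈ range (M + 1), (if n ≤ ns then A ^ d else 0) +
        ∑ n ∈ range (M + 1), (if ns < n then A ^ d * ((1 + 2 * (((n - ns : ℕ) : ℝ))) ^ d *
          Real.exp (-(a * ((n - ns : ℕ) : ℝ)))) else 0)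
      ≤ ((ns : ℝ) + 1) * A ^ d + A ^ d * ((Nat.factorial d : ℝ) * (6 / a) ^ d * (2 / a)) :=
        add_le_add hpart1 hpart2
    _ = A ^ d * ((ns : ℝ) + 1 + (Nat.factorial d : ℝ) * (6 / a) ^ d * (2 / a)) := by ring


end LCEval

/-! ### MZ13 Lemma 1 (v), norm part: the smoothing maps of `H` and `H + cV` differ by `O(|c|)` -/

section PerturbedSmoothing

variable {d L : ℕ} [NeZero L] {κ : Type*} [Fintype κ] [DecidableEq κ] {q : ℕ}

/-- `‖τ_u(A) B − B τ_u(A)‖ = ‖A τ_{−u}(B) − τ_{−u}(B) A‖` (conjugate by `τ_{−u}`). [folklore] -/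
theorem norm_comm_heisenbergEvolution_eq {n : Type*} [Fintype n] [DecidableEq n]
    {H : Matrix n n ℂ} (hH : H.IsHermitian) (A B : Matrix n n ℂ) (u : ℝ) :
    ‖heisenbergEvolution H u A * B - B * heisenbergEvolution H u A‖ =
      ‖A * heisenbergEvolution H (-u) B - heisenbergEvolution H (-u) B * A‖ := by
  have hB : B = heisenbergEvolution H u (heisenbergEvolution H (-u) B) := by
    rw [← heisenbergEvolution_add, add_neg_cancel, heisenbergEvolution_zero]
  conv_lhs => rw [hB]
  rw [← heisenbergEvolution_mul, ← heisenbergEvolution_mul, ← heisenbergEvolution_sub,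
    norm_heisenbergEvolution_holds hH]

/-- The floor in the Lieb–Robinson exponent: `n/(r₀+1) − 1 ≤ ⌊n/(r₀+1)⌋`. [folklore] -/
theorem div_sub_one_le_nat_div (n r₀ : ℕ) :
    (n : ℝ) / ((r₀ : ℝ) + 1) - 1 ≤ ((n / (r₀ + 1) : ℕ) : ℝ) := by
  have h := Nat.lt_div_mul_add (a := n) (Nat.succ_pos r₀)
  have h' : (n : ℝ) < ((n / (r₀ + 1) : ℕ) : ℝ) * ((r₀ : ℝ) + 1) + ((r₀ : ℝ) + 1) := by
    have := h; exact_mod_cast this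
  have hr : (0 : ℝ) < (r₀ : ℝ) + 1 := by positivity
  rw [sub_le_iff_le_add, div_le_iff₀ hr]
  linarith

/-- The class bound `g n` of `sum_norm_comm_heisenbergEvolution_le` is dominated by a single
`min 1 (C₁ e^{−a n + τ})` with `a = μ/(r₀+1)`, `C₁ = (|b_x(R)|/V + 1) e^{2μ}`, `τ = 2e^μ V J |t|`.
[folklore] -/
theorem classBound_le_min {r₀ n : ℕ} {C₀ μ v : ℝ} (hC₀ : 0 ≤ C₀) (hμ : 0 ≤ μ) (hv : 0 ≤ v) :
    (if r₀ + 1 ≤ n then min 1 (C₀ * Real.exp (-(μ * ((n / (r₀ + 1) : ℕ) : ℝ)) + v)) else (1 : ℝ)) ≤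
      min 1 ((C₀ + 1) * Real.exp (2 * μ) * Real.exp (-(μ / ((r₀ : ℝ) + 1) * n) + v)) := by
  have hr : (0 : ℝ) < (r₀ : ℝ) + 1 := by positivity
  have hfl := div_sub_one_le_nat_div n r₀
  split_ifs with h
  · refine min_le_min le_rfl ?_
    have h1 : Real.exp (-(μ * ((n / (r₀ + 1) : ℕ) : ℝ)) + v) ≤
        Real.exp (2 * μ) * Real.exp (-(μ / ((r₀ : ℝ) + 1) * n) + v) := by
      rw [← Real.exp_add, Real.exp_le_exp]
      have : μ / ((r₀ : ℝ) + 1) * n = μ * ((n : ℝ) / ((r₀ : ℝ) + 1)) := by ring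
      rw [this]
      nlinarith [mul_le_mul_of_nonneg_left hfl hμ]
    calc C₀ * Real.exp (-(μ * ((n / (r₀ + 1) : ℕ) : ℝ)) + v)
        ≤ C₀ * (Real.exp (2 * μ) * Real.exp (-(μ / ((r₀ : ℝ) + 1) * n) + v)) :=
          mul_le_mul_of_nonneg_left h1 hC₀
      _ ≤ (C₀ + 1) * (Real.exp (2 * μ) * Real.exp (-(μ / ((r₀ : ℝ) + 1) * n) + v)) :=
          mul_le_mul_of_nonneg_right (by linarith) (by positivity)
      _ = _ := by ring
  · -- `n ≤ r₀`: the right-hand side is at least `1`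
    refine le_min le_rfl ?_
    have hn : (n : ℝ) ≤ r₀ := by exact_mod_cast Nat.lt_succ_iff.mp (not_le.mp h)
    have h1 : 1 ≤ Real.exp (2 * μ) * Real.exp (-(μ / ((r₀ : ℝ) + 1) * n) + v) := by
      rw [← Real.exp_add]
      refine Real.one_le_exp ?_
      have h2 : μ / ((r₀ : ℝ) + 1) * n ≤ μ := by
        rw [div_mul_eq_mul_div, div_le_iff₀ hr]
        nlinarith
      linarith
    calc (1 : ℝ) ≤ 1 * (Real.exp (2 * μ) * Real.exp (-(μ / ((r₀ : ℝ) + 1) * n) + v)) := by linarith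
      _ ≤ (C₀ + 1) * (Real.exp (2 * μ) * Real.exp (-(μ / ((r₀ : ℝ) + 1) * n) + v)) :=
          mul_le_mul_of_nonneg_right (by linarith) (by positivity)
      _ = _ := by ring

/-- **MZ13 Lemma 1 (v), dynamics part: two finite-range dynamics compared, polynomially in
time and uniformly in the volume.** For the dynamics of a local interaction `Φ` (range `r₀`,
Lieb–Robinson data `(J, V)`) and of `H' = H_Φ − c H_W` (`W` local of range `r`, `‖W Z‖ ≤ 1`),
and `O ∈ 𝔄_{b_x(R)}`:
`‖τ_t^{Φ}(O) − τ_t^{H'}(O)‖ ≤ |c| |t| 2‖O‖ (1 + 2^{(2r+1)^d|κ|} |κ| P(|t|))` with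
`P(|t|) = (2(R+n⋆)+1)^d (n⋆ + 1 + d!(6/a)^d (2/a))`, `a = μ/(r₀+1)`,
`n⋆ = ⌈(2e^μ V J |t| + max 0 (log C₁))/a⌉₊`, `C₁ = (|b_x(R)|/V + 1) e^{2μ}` — Duhamel
(`norm_heisenbergEvolution_sub_heisenbergEvolution_le_of_le`) and the light-cone sum. Uniform in
`L`. [cite: MichalakisZwolakCMP2013, §5.1 Lemma 1 (v) (arXiv:1109.1588 pp. 9, 11)] -/
theorem norm_heisenbergEvolution_sub_perturbed_le {Φ : Interaction (TorusSite d L × κ) q}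
    (hΦ : Φ.IsLocal) {r₀ : ℕ} (hrange : ∀ Z, r₀ < torusDiam Z → Φ Z = 0)
    {J : ℝ} (hJ0 : 0 ≤ J)
    (hJ : ∀ y : TorusSite d L × κ, ∑ Z ∈ univ.filter (fun Z : Finset (TorusSite d L × κ) => y ∈ Z),
      ‖Φ Z‖ ≤ J)
    {V : ℕ} (hV1 : 1 ≤ V) (hV : ∀ Z, Φ Z ≠ 0 → #Z ≤ V)
    {W : Interaction (TorusSite d L × κ) q} (hW : W.IsLocal) {r : ℕ}
    (hWr : ∀ Z, r < torusDiam Z → W Z = 0) (hW1 : ∀ Z, ‖W Z‖ ≤ 1) (c : ℝ)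
    (x : TorusSite d L) {R : ℕ} {O : Op (TorusSite d L × κ) q} (hO : IsSupportedOn O (cellBall x R))
    {μ : ℝ} (hμ : 0 < μ) (t : ℝ) :
    ‖heisenbergEvolution (localHamiltonian Φ univ) t O -
        heisenbergEvolution (localHamiltonian Φ univ - (c : ℂ) • localHamiltonian W univ) t O‖ ≤
      |c| * |t| * (2 * ‖O‖ * (1 + 2 ^ ((2 * r + 1) ^ d * Fintype.card κ) * (Fintype.card κ *
        ((2 * ((R : ℝ) + ⌈(2 * Real.exp μ * V * J * |t| +
            max 0 (Real.log ((#(cellBall x R : Finset (TorusSite d L × κ)) / V + 1 : ℝ) * Real.exp (2 * μ)))) /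
              (μ / ((r₀ : ℝ) + 1))⌉₊) + 1) ^ d *
          ((⌈(2 * Real.exp μ * V * J * |t| +
            max 0 (Real.log ((#(cellBall x R : Finset (TorusSite d L × κ)) / V + 1 : ℝ) * Real.exp (2 * μ)))) /
              (μ / ((r₀ : ℝ) + 1))⌉₊ : ℝ) + 1 +
            (Nat.factorial d : ℝ) * (6 / (μ / ((r₀ : ℝ) + 1))) ^ d * (2 / (μ / ((r₀ : ℝ) + 1)))))))) := by
  set H : Op (TorusSite d L × κ) q := localHamiltonian Φ univ with hH
  set HW : Op (TorusSite d L × κ) q := localHamiltonian W univ with hHW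
  have hHh : H.IsHermitian := localHamiltonian_isHermitian hΦ univ
  have hHWh : HW.IsHermitian := localHamiltonian_isHermitian hW univ
  have hcHW : ((c : ℂ) • HW).IsHermitian := by
    unfold Matrix.IsHermitian
    rw [conjTranspose_smul, hHWh.eq, Complex.star_def, Complex.conj_ofReal]
  have hH'h : (H - (c : ℂ) • HW).IsHermitian := hHh.sub hcHW
  set a : ℝ := μ / ((r₀ : ℝ) + 1) with ha
  have ha0 : 0 < a := div_pos hμ (by positivity)
  set C₁ : ℝ := (#(cellBall x R : Finset (TorusSite d L × κ)) / V + 1 : ℝ) * Real.exp (2 * μ) with hC₁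
  have hC₁0 : 0 ≤ C₁ := by positivity
  -- the Duhamel bound with a uniform commutator estimate on `|u| ≤ |t|`
  suffices key : ∀ u : ℝ, |u| ≤ |t| →
      ‖heisenbergEvolution H u (H - (H - (c : ℂ) • HW)) * O - O * heisenbergEvolution H u (H - (H - (c : ℂ) • HW))‖ ≤
        |c| * (2 * ‖O‖ * (1 + 2 ^ ((2 * r + 1) ^ d * Fintype.card κ) * (Fintype.card κ *
          ((2 * ((R : ℝ) + ⌈(2 * Real.exp μ * V * J * |t| + max 0 (Real.log C₁)) / a⌉₊) + 1) ^ d *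
            ((⌈(2 * Real.exp μ * V * J * |t| + max 0 (Real.log C₁)) / a⌉₊ : ℝ) + 1 +
              (Nat.factorial d : ℝ) * (6 / a) ^ d * (2 / a)))))) by
    have h := norm_heisenbergEvolution_sub_heisenbergEvolution_le_of_le hHh hH'h O key
    refine h.trans (le_of_eq ?_)
    ring
  intro u hu
  -- `H − H' = c H_W`
  have hdiff : H - (H - (c : ℂ) • HW) = (c : ℂ) • HW := by abel
  have hsmul : heisenbergEvolution H u ((c : ℂ) • HW) = (c : ℂ) • heisenbergEvolution H u HW := by
    simp only [heisenbergEvolution, Matrix.mul_smul, Matrix.smul_mul]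
  rw [hdiff, hsmul, Matrix.smul_mul, Matrix.mul_smul, ← smul_sub, norm_smul,
    Complex.norm_real, Real.norm_eq_abs]
  -- `‖[τ_u(H_W), O]‖ = ‖[H_W, τ_{-u} O]‖ ≤ Σ_Z ‖[W Z, τ_{-u} O]‖`
  rw [norm_comm_heisenbergEvolution_eq hHh]
  have hsum : ‖HW * heisenbergEvolution H (-u) O - heisenbergEvolution H (-u) O * HW‖ ≤
      ∑ Z : Finset (TorusSite d L × κ), ‖W Z * heisenbergEvolution H (-u) O -
        heisenbergEvolution H (-u) O * W Z‖ := by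
    rw [hHW, localHamiltonian_univ, Finset.sum_mul, Finset.mul_sum, ← Finset.sum_sub_distrib]
    exact norm_sum_le _ _
  have hLC := sum_norm_comm_heisenbergEvolution_le hΦ hrange hJ0 hJ hV1 hV hW hWr hW1 x hO hμ.le (-u)
  rw [abs_neg] at hLC
  refine mul_le_mul_of_nonneg_left (hsum.trans (hLC.trans ?_)) (abs_nonneg c)
  refine mul_le_mul_of_nonneg_left (add_le_add le_rfl (mul_le_mul_of_nonneg_left ?_ (by positivity)))
    (by positivity)
  -- compare the class sum with the evaluated light-cone sum at time `|t|`
  have hVr : (0 : ℝ) < V := by exact_mod_cast hV1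
  have hcls : ∀ n ∈ range (L + 1), (#(cellBall x (R + n) : Finset (TorusSite d L × κ)) : ℝ) *
      (if r₀ + 1 ≤ n then min 1 ((#(cellBall x R : Finset (TorusSite d L × κ)) / V : ℝ) *
        Real.exp (-(μ * ((n / (r₀ + 1) : ℕ) : ℝ)) + 2 * Real.exp μ * V * J * |u|)) else 1) ≤
      Fintype.card κ * ((2 * ((R : ℝ) + n) + 1) ^ d *
        min 1 (C₁ * Real.exp (-(a * n) + 2 * Real.exp μ * V * J * |t|))) := by
    intro n _
    have hcard : (#(cellBall x (R + n) : Finset (TorusSite d L × κ)) : ℝ) ≤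
        Fintype.card κ * (2 * ((R : ℝ) + n) + 1) ^ d := by
      have h1 := card_cellBall_le (κ := κ) x (R + n)
      have h2 : (#(cellBall x (R + n) : Finset (TorusSite d L × κ)) : ℝ) ≤
          (((2 * (R + n) + 1) ^ d * Fintype.card κ : ℕ) : ℝ) := by exact_mod_cast h1
      refine h2.trans (le_of_eq ?_); push_cast; ring
    have hg := classBound_le_min (r₀ := r₀) (n := n)
      (C₀ := (#(cellBall x R : Finset (TorusSite d L × κ)) / V : ℝ)) (μ := μ)
      (v := 2 * Real.exp μ * V * J * |u|) (by positivity) hμ.le (by positivity)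
    -- monotonicity in the time: `|u| ≤ |t|`
    have hmono : min 1 (((#(cellBall x R : Finset (TorusSite d L × κ)) / V : ℝ) + 1) * Real.exp (2 * μ) *
        Real.exp (-(μ / ((r₀ : ℝ) + 1) * n) + 2 * Real.exp μ * V * J * |u|)) ≤
        min 1 (C₁ * Real.exp (-(a * n) + 2 * Real.exp μ * V * J * |t|)) := by
      refine min_le_min le_rfl ?_
      rw [hC₁, ha]
      refine mul_le_mul_of_nonneg_left ?_ (by positivity)
      rw [Real.exp_le_exp]
      have : 0 ≤ 2 * Real.exp μ * V * J := by positivity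
      nlinarith
    have hgn : 0 ≤ (if r₀ + 1 ≤ n then min 1 ((#(cellBall x R : Finset (TorusSite d L × κ)) / V : ℝ) *
        Real.exp (-(μ * ((n / (r₀ + 1) : ℕ) : ℝ)) + 2 * Real.exp μ * V * J * |u|)) else (1 : ℝ)) := by
      split_ifs
      · exact le_min zero_le_one (by positivity)
      · exact zero_le_one
    calc _ ≤ (Fintype.card κ * (2 * ((R : ℝ) + n) + 1) ^ d) *
          min 1 (C₁ * Real.exp (-(a * n) + 2 * Real.exp μ * V * J * |t|)) :=
          mul_le_mul hcard (hg.trans hmono) hgn (by positivity)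
      _ = _ := by ring
  refine (sum_le_sum hcls).trans ?_
  rw [← mul_sum]
  refine mul_le_mul_of_nonneg_left ?_ (Nat.cast_nonneg _)
  exact sum_pow_mul_min_exp_le ha0 hC₁0 R d L

end PerturbedSmoothing

/-! ### MZ13 Lemma 1 (v), norm part at the level of the smoothing maps -/

section PerturbedSmoothingNorm

open MeasureTheory

variable {d L : ℕ} [NeZero L] {κ : Type*} [Fintype κ] [DecidableEq κ] {q : ℕ}

/-- `(x + y)^n ≤ 2^n (x^n + y^n)` for `x, y ≥ 0` (a private copy of a folklore inequality
that several Literature files state under this name). [folklore] -/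
private theorem add_pow_le_two_pow_mul_add_pow {x y : ℝ} (hx : 0 ≤ x) (hy : 0 ≤ y) (n : ℕ) :
    (x + y) ^ n ≤ 2 ^ n * (x ^ n + y ^ n) := by
  have h1 : x + y ≤ 2 * max x y := by
    rcases le_total x y with h | h
    · rw [max_eq_right h]; linarith
    · rw [max_eq_left h]; linarith
  have h2 : (max x y) ^ n ≤ x ^ n + y ^ n := by
    rcases le_total x y with h | h
    · rw [max_eq_right h]; linarith [pow_nonneg hx n]
    · rw [max_eq_left h]; linarith [pow_nonneg hy n]
  calc (x + y) ^ n ≤ (2 * max x y) ^ n := pow_le_pow_left₀ (by positivity) h1 n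
    _ = 2 ^ n * (max x y) ^ n := mul_pow _ _ _
    _ ≤ 2 ^ n * (x ^ n + y ^ n) := mul_le_mul_of_nonneg_left h2 (by positivity)

/-- The polynomial factor of `norm_heisenbergEvolution_sub_perturbed_le` is dominated by
`2^{d+1}(B₀^{d+1} + B₁^{d+1}|t|^{d+1})` with `B₀ = 2R + 3 + 2m₀/a + D`, `B₁ = 2v/a`
(`m₀ = max 0 (log C₁)`, `D = d!(6/a)^d(2/a)`). [folklore] -/
theorem lightConePoly_le {a v m₀ D : ℝ} (ha : 0 < a) (hv : 0 ≤ v) (hm₀ : 0 ≤ m₀) (hD : 0 ≤ D)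
    (R d : ℕ) (t : ℝ) :
    (2 * ((R : ℝ) + ⌈(v * |t| + m₀) / a⌉₊) + 1) ^ d * ((⌈(v * |t| + m₀) / a⌉₊ : ℝ) + 1 + D) ≤
      2 ^ (d + 1) * ((2 * (R : ℝ) + 3 + 2 * m₀ / a + D) ^ (d + 1) +
        (2 * v / a) ^ (d + 1) * |t| ^ (d + 1)) := by
  set y : ℝ := (v * |t| + m₀) / a + 1 with hy
  have harg : 0 ≤ (v * |t| + m₀) / a := div_nonneg (by positivity) ha.le
  have hceil : (⌈(v * |t| + m₀) / a⌉₊ : ℝ) ≤ y := (Nat.ceil_lt_add_one harg).le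
  have hy0 : 0 ≤ y := by rw [hy]; linarith
  set B₀ : ℝ := 2 * (R : ℝ) + 3 + 2 * m₀ / a + D with hB₀
  set B₁ : ℝ := 2 * v / a with hB₁
  have hB₁0 : 0 ≤ B₁ := by rw [hB₁]; positivity
  have hyexp : y = m₀ / a + 1 + (v / a) * |t| := by rw [hy]; ring
  have hva : 0 ≤ v / a * |t| := by positivity
  have hm₀a : 0 ≤ m₀ / a := div_nonneg hm₀ ha.le
  -- both factors are at most `B₀ + B₁ |t|`
  have e1 : B₀ + B₁ * |t| - (2 * ((R : ℝ) + y) + 1) = D := by rw [hy, hB₀, hB₁]; ring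
  have e2 : B₀ + B₁ * |t| - (y + 1 + D) = 2 * (R : ℝ) + 1 + m₀ / a + (v / a) * |t| := by
    rw [hy, hB₀, hB₁]; ring
  have hR0 := (Nat.cast_nonneg R : (0 : ℝ) ≤ R)
  have hf1 : 2 * ((R : ℝ) + ⌈(v * |t| + m₀) / a⌉₊) + 1 ≤ B₀ + B₁ * |t| := by linarith
  have hf2 : (⌈(v * |t| + m₀) / a⌉₊ : ℝ) + 1 + D ≤ B₀ + B₁ * |t| := by linarith
  have hf1' : 0 ≤ 2 * ((R : ℝ) + ⌈(v * |t| + m₀) / a⌉₊) + 1 := by positivity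
  have hf2' : 0 ≤ (⌈(v * |t| + m₀) / a⌉₊ : ℝ) + 1 + D := by positivity
  have hB₀0 : 0 ≤ B₀ := by rw [hB₀]; positivity
  calc (2 * ((R : ℝ) + ⌈(v * |t| + m₀) / a⌉₊) + 1) ^ d * ((⌈(v * |t| + m₀) / a⌉₊ : ℝ) + 1 + D)
      ≤ (B₀ + B₁ * |t|) ^ d * (B₀ + B₁ * |t|) :=
        mul_le_mul (pow_le_pow_left₀ hf1' hf1 d) hf2 hf2' (by positivity)
    _ = (B₀ + B₁ * |t|) ^ (d + 1) := by rw [pow_succ]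
    _ ≤ 2 ^ (d + 1) * (B₀ ^ (d + 1) + (B₁ * |t|) ^ (d + 1)) :=
        add_pow_le_two_pow_mul_add_pow hB₀0 (by positivity) (d + 1)
    _ = _ := by rw [mul_pow]

/-- **MZ13 Lemma 1 (v), norm part: the smoothing maps of `H_Φ` and of `H_Φ − cH_W` differ by
`O(|c|)`, uniformly in the volume.** With the data of `norm_heisenbergEvolution_sub_perturbed_le`
and a weight `w` with `∫|w||t|` and `∫|w||t|^{d+2}` finite:
`‖∫ w(t) τ_t^{Φ}(O) dt − ∫ w(t) τ_t^{H'}(O) dt‖ ≤ |c| ‖O‖ · 2 (M₁ (1 + A K₀) + A K₁ M_{d+2})`,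
`A = 2^{(2r+1)^d|κ|}|κ|`, `K₀ = 2^{d+1}B₀^{d+1}`, `K₁ = 2^{d+1}B₁^{d+1}`, `M_k = ∫ |w(t)||t|^k dt`
("`‖𝓕_s(Q_u) − 𝓕₀(Q_u)‖ ≤ s·(…)·J`", arXiv:1109.1588 p. 11). [cite: MichalakisZwolakCMP2013, §5.1 Lemma 1 (v) (arXiv:1109.1588 pp. 9, 11)] -/
theorem norm_smoothing_sub_perturbed_le {Φ : Interaction (TorusSite d L × κ) q}
    (hΦ : Φ.IsLocal) {r₀ : ℕ} (hrange : ∀ Z, r₀ < torusDiam Z → Φ Z = 0)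
    {J : ℝ} (hJ0 : 0 ≤ J)
    (hJ : ∀ y : TorusSite d L × κ, ∑ Z ∈ univ.filter (fun Z : Finset (TorusSite d L × κ) => y ∈ Z),
      ‖Φ Z‖ ≤ J)
    {V : ℕ} (hV1 : 1 ≤ V) (hV : ∀ Z, Φ Z ≠ 0 → #Z ≤ V)
    {W : Interaction (TorusSite d L × κ) q} (hW : W.IsLocal) {r : ℕ}
    (hWr : ∀ Z, r < torusDiam Z → W Z = 0) (hW1 : ∀ Z, ‖W Z‖ ≤ 1) (c : ℝ)
    (x : TorusSite d L) {R : ℕ} {O : Op (TorusSite d L × κ) q} (hO : IsSupportedOn O (cellBall x R))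
    {μ : ℝ} (hμ : 0 < μ) {w : ℝ → ℂ} (hw : Integrable w)
    (hm1 : Integrable fun t : ℝ => ‖w t‖ * |t|)
    (hmd : Integrable fun t : ℝ => ‖w t‖ * |t| ^ (d + 2)) :
    ‖(∫ t : ℝ, w t • heisenbergEvolution (localHamiltonian Φ univ) t O) -
        ∫ t : ℝ, w t • heisenbergEvolution
          (localHamiltonian Φ univ - (c : ℂ) • localHamiltonian W univ) t O‖ ≤
      |c| * ‖O‖ * (2 * ((∫ t : ℝ, ‖w t‖ * |t|) *
        (1 + 2 ^ ((2 * r + 1) ^ d * Fintype.card κ) * Fintype.card κ *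
          (2 ^ (d + 1) * (2 * (R : ℝ) + 3 +
            2 * max 0 (Real.log ((#(cellBall x R : Finset (TorusSite d L × κ)) / V + 1 : ℝ) * Real.exp (2 * μ))) /
              (μ / ((r₀ : ℝ) + 1)) +
            (Nat.factorial d : ℝ) * (6 / (μ / ((r₀ : ℝ) + 1))) ^ d * (2 / (μ / ((r₀ : ℝ) + 1)))) ^ (d + 1))) +
        2 ^ ((2 * r + 1) ^ d * Fintype.card κ) * Fintype.card κ *
          (2 ^ (d + 1) * (2 * (2 * Real.exp μ * V * J) / (μ / ((r₀ : ℝ) + 1))) ^ (d + 1)) *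
            ∫ t : ℝ, ‖w t‖ * |t| ^ (d + 2))) := by
  set H : Op (TorusSite d L × κ) q := localHamiltonian Φ univ with hH
  set H' : Op (TorusSite d L × κ) q := localHamiltonian Φ univ - (c : ℂ) • localHamiltonian W univ with hH'
  have hHh : H.IsHermitian := localHamiltonian_isHermitian hΦ univ
  have hHWh : (localHamiltonian W univ).IsHermitian := localHamiltonian_isHermitian hW univ
  have hcHW : ((c : ℂ) • localHamiltonian W univ).IsHermitian := by
    unfold Matrix.IsHermitian
    rw [conjTranspose_smul, hHWh.eq, Complex.star_def, Complex.conj_ofReal]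
  have hH'h : H'.IsHermitian := hHh.sub hcHW
  set a : ℝ := μ / ((r₀ : ℝ) + 1) with ha
  have ha0 : 0 < a := div_pos hμ (by positivity)
  set v : ℝ := 2 * Real.exp μ * V * J with hv
  have hv0 : 0 ≤ v := by positivity
  set m₀ : ℝ := max 0 (Real.log ((#(cellBall x R : Finset (TorusSite d L × κ)) / V + 1 : ℝ) * Real.exp (2 * μ)))
    with hm₀
  have hm₀0 : 0 ≤ m₀ := le_max_left _ _
  set D : ℝ := (Nat.factorial d : ℝ) * (6 / a) ^ d * (2 / a) with hD
  have hD0 : 0 ≤ D := by positivity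
  set A : ℝ := 2 ^ ((2 * r + 1) ^ d * Fintype.card κ) * Fintype.card κ with hA
  have hA0 : 0 ≤ A := by positivity
  set K₀ : ℝ := 2 ^ (d + 1) * (2 * (R : ℝ) + 3 + 2 * m₀ / a + D) ^ (d + 1) with hK₀
  set K₁ : ℝ := 2 ^ (d + 1) * (2 * v / a) ^ (d + 1) with hK₁
  have hK₀0 : 0 ≤ K₀ := by positivity
  have hK₁0 : 0 ≤ K₁ := by positivity
  have hO0 := norm_nonneg O
  -- the pointwise majorant
  set g : ℝ → ℝ := fun t => |c| * ‖O‖ * (2 * ((1 + A * K₀) * (‖w t‖ * |t|) + A * K₁ * (‖w t‖ * |t| ^ (d + 2))))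
    with hg
  have hgi : Integrable g := by
    exact ((hm1.const_mul (1 + A * K₀)).add (hmd.const_mul (A * K₁))).const_mul (2 : ℝ) |>.const_mul (|c| * ‖O‖)
      |>.congr (Filter.Eventually.of_forall fun t => by simp only [hg, Pi.add_apply])
  have hpt : ∀ t : ℝ, ‖w t • heisenbergEvolution H t O - w t • heisenbergEvolution H' t O‖ ≤ g t := by
    intro t
    rw [← smul_sub, norm_smul]
    have hdyn := norm_heisenbergEvolution_sub_perturbed_le hΦ hrange hJ0 hJ hV1 hV hW hWr hW1 c x hO hμ t
    have hpoly := lightConePoly_le ha0 hv0 hm₀0 hD0 R d t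
    -- `1 + 2^N |κ| P ≤ 1 + A (K₀ + K₁ |t|^{d+1})`
    have h1 : 1 + 2 ^ ((2 * r + 1) ^ d * Fintype.card κ) * (Fintype.card κ *
        ((2 * ((R : ℝ) + ⌈(v * |t| + m₀) / a⌉₊) + 1) ^ d * ((⌈(v * |t| + m₀) / a⌉₊ : ℝ) + 1 + D))) ≤
        1 + A * (K₀ + K₁ * |t| ^ (d + 1)) := by
      rw [hA, hK₀, hK₁]
      have : 2 ^ ((2 * r + 1) ^ d * Fintype.card κ) * (Fintype.card κ *
          ((2 * ((R : ℝ) + ⌈(v * |t| + m₀) / a⌉₊) + 1) ^ d * ((⌈(v * |t| + m₀) / a⌉₊ : ℝ) + 1 + D))) =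
          (2 ^ ((2 * r + 1) ^ d * Fintype.card κ) * Fintype.card κ) *
          ((2 * ((R : ℝ) + ⌈(v * |t| + m₀) / a⌉₊) + 1) ^ d * ((⌈(v * |t| + m₀) / a⌉₊ : ℝ) + 1 + D)) := by ring
      rw [this]
      refine add_le_add le_rfl (mul_le_mul_of_nonneg_left (hpoly.trans (le_of_eq (by ring))) (by positivity))
    have h2 : ‖heisenbergEvolution H t O - heisenbergEvolution H' t O‖ ≤
        |c| * |t| * (2 * ‖O‖ * (1 + A * (K₀ + K₁ * |t| ^ (d + 1)))) :=
      hdyn.trans (mul_le_mul_of_nonneg_left (mul_le_mul_of_nonneg_left h1 (by positivity)) (by positivity))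
    calc ‖w t‖ * ‖heisenbergEvolution H t O - heisenbergEvolution H' t O‖
        ≤ ‖w t‖ * (|c| * |t| * (2 * ‖O‖ * (1 + A * (K₀ + K₁ * |t| ^ (d + 1))))) :=
          mul_le_mul_of_nonneg_left h2 (norm_nonneg _)
      _ = g t := by simp only [hg]; ring
  -- integrate
  have hint : Integrable fun t : ℝ => w t • heisenbergEvolution H t O :=
    integrable_smul_heisenbergEvolution hHh hw O
  have hint' : Integrable fun t : ℝ => w t • heisenbergEvolution H' t O :=
    integrable_smul_heisenbergEvolution hH'h hw O
  rw [← integral_sub hint hint']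
  refine (norm_integral_le_of_norm_le hgi (Filter.Eventually.of_forall hpt)).trans (le_of_eq ?_)
  simp only [hg]
  rw [integral_const_mul, integral_const_mul, integral_add (hm1.const_mul _) (hmd.const_mul _),
    integral_const_mul, integral_const_mul]
  ring

end PerturbedSmoothingNorm

end Literature.MathematicalPhysics.QuantumLattice
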